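import Literature.Combinatorics.Designs.LegendrePairs.NineCompression333

/-!
# Legendre pairs of length 333: surjective mod-37 compression, parity form (RHdQ Table A1 rows 25, 26, 27, 29)

Independent kernel-checked re-proof of four PUBLISHED exclusions of [RamosHulakDeQueiroz2026, §3.3 "surjective mod-37
compression": IDs 25 `⟨10,19⟩`, 26 `⟨4,13⟩`, 27 `⟨7,22⟩`, 29 `⟨4,7,13⟩`], by a different argument from the paper's
(parity + row sum instead of DFT + sums of two squares), and in a stronger form: ONE sequence invariant under ONE
multiplier `g` whose reduction mod 37 is a primitive root already contradicts the row-sum condition `Σ a = ±1`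
(`rowsum_sq`, [FletcherGysinSeberry2001]).

Argument: the 37-compression `d_k = Σ_{i ≡ k (37)} a_i` (nine `±1` terms, so odd, `|d_k| ≤ 9`; compression as in
[DjokovicKotsireas2015]) satisfies `d_{g k} = d_k`; if `g mod 37` generates `(ℤ/37)ˣ` then `d_1 = … = d_36 =: c`, and
`Σ a = d_0 + 36 c = ±1` forces `36 |c| ≤ 10`, i.e. `c = 0`, contradicting `c` odd.  Notation `χ`, `cs` from
`NineCompression333.lean`.

PROVENANCE.  Statements = published rows; this proof is the pub-lottery cell's (2026-08-19, audited by seat 2).  No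
`native_decide`; primitivity of `19, 13, 22 (mod 37)` enters as two `decide`d facts about the induced map `σ g`.
-/

open Finset

set_option maxRecDepth 16384

namespace Literature.Combinatorics.Designs.LegendrePairs

namespace Comp37_333

open NineComp333

/-! ### the 37-compression -/

/-- the class `{i ≡ k (mod 37)}` has 9 elements [folklore] -/
lemma card_class37 (k : ℕ) (hk : k < 37) : ∑ i : ZMod 333, χ 37 k i = 9 := by
  unfold χ
  interval_cases k <;> decide

/-- each mod-37 class sum of a `±1` sequence of length 333 is odd (9 terms). [cite: RamosHulakDeQueiroz2026, §3.3 (surjective mod-37 compression)] -/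
lemma cs37_odd (c : ZMod 333 → ℤ) (hc : IsPM c) (k : ℕ) (hk : k < 37) : Odd (cs 37 c k) := by
  have hsplit : cs 37 c k = ∑ i, χ 37 k i * (c i - 1) + ∑ i, χ 37 k i := by
    unfold cs; rw [← Finset.sum_add_distrib]
    refine Finset.sum_congr rfl fun i _ => ?_; ring
  have heven : (2 : ℤ) ∣ ∑ i : ZMod 333, χ 37 k i * (c i - 1) :=
    Finset.dvd_sum fun i _ => by
      rcases hc i with h | h
      · rw [h]; simp
      · rw [h]; exact Dvd.dvd.mul_left (by norm_num) _
  rw [hsplit, card_class37 k hk]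
  obtain ⟨m, hm⟩ := heven
  exact ⟨m + 4, by rw [hm]; ring⟩

/-- each mod-37 class sum of a `±1` sequence of length 333 lies in `[-9, 9]`. [folklore] -/
lemma cs37_abs (c : ZMod 333 → ℤ) (hc : IsPM c) (k : ℕ) (hk : k < 37) :
    cs 37 c k ≤ 9 ∧ -9 ≤ cs 37 c k := by
  have hχ : ∀ i, (0 : ℤ) ≤ χ 37 k i := fun i => by unfold χ; split_ifs <;> norm_num
  have up : cs 37 c k ≤ ∑ i, χ 37 k i := by
    unfold cs
    refine Finset.sum_le_sum fun i _ => ?_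
    rcases hc i with h | h <;> rw [h] <;> nlinarith [hχ i]
  have dn : -(∑ i, χ 37 k i) ≤ cs 37 c k := by
    unfold cs; rw [← Finset.sum_neg_distrib]
    refine Finset.sum_le_sum fun i _ => ?_
    rcases hc i with h | h <;> rw [h] <;> nlinarith [hχ i]
  rw [card_class37 k hk] at up dn
  exact ⟨up, by linarith⟩

/-- `Σ a` splits into the 37 class sums [folklore] -/
lemma rowsum_eq37 (c : ZMod 333 → ℤ) : ∑ i, c i = ∑ k ∈ Finset.range 37, cs 37 c k := by
  unfold cs
  rw [Finset.sum_comm]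
  refine Finset.sum_congr rfl fun i _ => ?_
  rw [← Finset.sum_mul]
  have : ∑ k ∈ Finset.range 37, χ 37 k i = 1 := by
    unfold χ
    rw [Finset.sum_ite_eq]
    rw [if_pos (Finset.mem_range.mpr (Nat.mod_lt _ (by norm_num)))]
  rw [this, one_mul]

/-- the induced map on residues mod 37 [folklore] -/
def σ (g : ZMod 333) (k : ℕ) : ℕ := (g.val % 37) * k % 37

/-- `σ g k < 37`. [folklore] -/
lemma σ_lt (g : ZMod 333) (k : ℕ) : σ g k < 37 := Nat.mod_lt _ (by norm_num)

/-- TIE: invariance under the unit `g` identifies class `k` with class `σ g k`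
(injectivity of `σ g` on `{0,…,36}` is supplied as a `decide`d hypothesis). [cite: RamosHulakDeQueiroz2026, §3.3 (surjective mod-37 compression); tie form] -/
lemma cs37_tie (c : ZMod 333 → ℤ) (g : ZMod 333) (u : (ZMod 333)ˣ) (hu : (u : ZMod 333) = g)
    (hinv : ∀ i, c (g * i) = c i)
    (hinj : ∀ x ∈ Finset.range 37, ∀ y ∈ Finset.range 37, σ g x = σ g y → x = y)
    (k : ℕ) (hk : k < 37) : cs 37 c (σ g k) = cs 37 c k := by
  unfold cs
  rw [← Equiv.sum_comp u.mulLeft (fun j => χ 37 (σ g k) j * c j)]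
  refine Finset.sum_congr rfl fun i _ => ?_
  show χ 37 (σ g k) ((u : ZMod 333) * i) * c ((u : ZMod 333) * i) = χ 37 k i * c i
  rw [hu, hinv]
  congr 1
  unfold χ
  have hgi : (g * i).val % 37 = σ g (i.val % 37) := by
    unfold σ; rw [val_mul_mod (by decide : 37 ∣ 333), Nat.mul_mod]
  have hi : i.val % 37 < 37 := Nat.mod_lt _ (by norm_num)
  have key : (g * i).val % 37 = σ g k ↔ i.val % 37 = k := by
    rw [hgi]
    constructor
    · intro h
      exact hinj _ (Finset.mem_range.mpr hi) _ (Finset.mem_range.mpr hk) h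
    · intro h; rw [h]
  by_cases h : i.val % 37 = k
  · rw [if_pos (key.mpr h), if_pos h]
  · rw [if_neg (fun h' => h (key.mp h')), if_neg h]

/-- iterates of `σ g` stay below `37`. [folklore] -/
lemma iter_lt (g : ZMod 333) : ∀ m : ℕ, (σ g)^[m] 1 < 37
  | 0 => by simp
  | m + 1 => by rw [Function.iterate_succ_apply']; exact σ_lt g _

/-- class sums are constant along the `σ g`-orbit of `1`. [cite: RamosHulakDeQueiroz2026, §3.3] -/
lemma cs37_iter (c : ZMod 333 → ℤ) (g : ZMod 333) (u : (ZMod 333)ˣ) (hu : (u : ZMod 333) = g)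
    (hinv : ∀ i, c (g * i) = c i)
    (hinj : ∀ x ∈ Finset.range 37, ∀ y ∈ Finset.range 37, σ g x = σ g y → x = y) :
    ∀ m : ℕ, cs 37 c ((σ g)^[m] 1) = cs 37 c 1
  | 0 => by simp
  | m + 1 => by
      rw [Function.iterate_succ_apply', cs37_tie c g u hu hinv hinj _ (iter_lt g m)]
      exact cs37_iter c g u hu hinv hinj m

/-- **Theorem (generic form).**  If `g` is a unit of `ZMod 333` whose reduction mod 37 generates `(ℤ/37)ˣ`
(supplied as two `decide`d facts about `σ g`), then no Legendre pair of length 333 has its FIRST sequence invariant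
under the multiplier `g` (nothing is assumed about the second sequence). [cite: RamosHulakDeQueiroz2026, §3.3 / Table A1 rows 25, 26, 27, 29 (there: DFT + two-squares argument, both sequences); parity proof with ONE sequence and ONE generator here — pub-lottery cell] -/
theorem no_legendrePair_primroot37 (g : ZMod 333) (u : (ZMod 333)ˣ) (hu : (u : ZMod 333) = g)
    (hinj : ∀ x ∈ Finset.range 37, ∀ y ∈ Finset.range 37, σ g x = σ g y → x = y)
    (htrans : ∀ k ∈ Finset.range 37, k ≠ 0 → ∃ m ∈ Finset.range 36, (σ g)^[m] 1 = k)
    (a b : ZMod 333 → ℤ) (hL : LegendrePair a b) (ha : ∀ i, a (g * i) = a i) : False := by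
  have hpa : IsPM a := hL.1
  have hsa : (∑ i, a i) = 1 ∨ (∑ i, a i) = -1 := pm_of_sq _ _ (rowsum_sq a b hL)
  -- all nonzero classes are equal to class 1
  have hconst : ∀ k ∈ Finset.range 36, cs 37 a (k + 1) = cs 37 a 1 := by
    intro k hk
    have hk37 : k + 1 ∈ Finset.range 37 := by
      rw [Finset.mem_range] at hk ⊢; omega
    obtain ⟨m, _, hm⟩ := htrans (k + 1) hk37 (Nat.succ_ne_zero k)
    rw [← hm]
    exact cs37_iter a g u hu ha hinj m
  have hrow : ∑ i, a i = cs 37 a 0 + 36 * cs 37 a 1 := by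
    rw [rowsum_eq37, Finset.sum_range_succ', Finset.sum_congr rfl hconst]
    simp [Finset.sum_const, Finset.card_range]
    ring
  have hodd := cs37_odd a hpa 1 (by norm_num)
  have hb0 := cs37_abs a hpa 0 (by norm_num)
  obtain ⟨t, ht⟩ := hodd
  obtain ⟨h0u, h0l⟩ := hb0
  rcases hsa with h | h <;> rw [hrow] at h <;> omega

/-! ### Instances: RHdQ Table A1 rows 25, 26, 27, 29.
In each row one listed generator is already a primitive root mod 37 (19, 13, 22, 13), so invariance of ONE sequence under
that ONE generator suffices; the remaining generators of the row are not needed. -/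

/-- row 25 `⟨10, 19⟩`: `19 mod 37` is a primitive root. [cite: RamosHulakDeQueiroz2026, Table A1 row 25 (surjective mod-37 compression); re-proved here, one sequence] -/
theorem rhdq_tableA1_id25 (a b : ZMod 333 → ℤ) (hL : LegendrePair a b)
    (ha19 : ∀ i, a (19 * i) = a i) : False :=
  no_legendrePair_primroot37 19 (ZMod.unitOfCoprime 19 (by decide)) (by simp)
    (by decide) (by decide) a b hL ha19

/-- rows 26 `⟨4, 13⟩` and 29 `⟨4, 7, 13⟩`: `13 mod 37` is a primitive root. [cite: RamosHulakDeQueiroz2026, Table A1 rows 26, 29 (surjective mod-37 compression); re-proved here, one sequence] -/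
theorem rhdq_tableA1_id26_id29 (a b : ZMod 333 → ℤ) (hL : LegendrePair a b)
    (ha13 : ∀ i, a (13 * i) = a i) : False :=
  no_legendrePair_primroot37 13 (ZMod.unitOfCoprime 13 (by decide)) (by simp)
    (by decide) (by decide) a b hL ha13

/-- row 27 `⟨7, 22⟩`: `22 mod 37` is a primitive root. [cite: RamosHulakDeQueiroz2026, Table A1 row 27 (surjective mod-37 compression); re-proved here, one sequence] -/
theorem rhdq_tableA1_id27 (a b : ZMod 333 → ℤ) (hL : LegendrePair a b)
    (ha22 : ∀ i, a (22 * i) = a i) : False :=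
  no_legendrePair_primroot37 22 (ZMod.unitOfCoprime 22 (by decide)) (by simp)
    (by decide) (by decide) a b hL ha22

end Comp37_333

end Literature.Combinatorics.Designs.LegendrePairs
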